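import Mathlib.RingTheory.LaurentSeries
import Mathlib.RingTheory.Valuation.Discrete.RankOne
import Mathlib.Topology.Algebra.Valued.NormedValued
import Mathlib.RingTheory.DedekindDomain.AdicValuation
import Mathlib.Analysis.SpecialFunctions.Exp
import Mathlib.Analysis.Normed.Unbundled.SpectralNorm
import Mathlib.FieldTheory.IsAlgClosed.AlgebraicClosure
import HarnessLib

/-!
# Nesterenko's multiplicity estimate (LNM 1752 Ch. 10 §2): the valued fields `ℂ⸨z⸩` and `𝒦`

`Literature/NumberTheory/Transcendental/NesterenkoMultiplicityValuedField.lean` — definitions (type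
synonyms with instances) and proved lemmas; no named facts. LNM 1752 Ch. 10 §2 (p. 152): "define an
absolute value on `K = ℂ(z)` by `|α| = e^{−ord α}` … its completion … and `𝒦`, an algebraically closed
field containing it, to which `| |` extends". This file constructs the data `(L, ι, hι)` consumed by the
Ch. 10 assembly (`NesterenkoMultiplicityTheorem.thm_1_1_of_toolkit`, hypothesis `hι : ‖ι φ‖ = e^{−ord φ}`):

* `CLaurent` — a type synonym of `ℂ⸨X⸩ = LaurentSeries ℂ` with Mathlib's `X`-adic valuation, made a
  `NontriviallyNormedField` through `Valued.toNormedField` for the rank-one structure of base `e`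
  (`‖x‖ = e^{log-valuation}`, `norm_eq_toNNReal`); complete, ultrametric, an algebra over `ℂ`, `ℂ[X]`,
  `ℂ⟦X⟧` and `RatFunc ℂ` (the latter through `RatFunc.liftAlgebra`) with the scalar towers;
  `norm_algebraMap_powerSeries : ‖φ‖ = e^{−ord φ}`.
* `CzBar` — a type synonym of `AlgebraicClosure CLaurent` with the spectral norm
  (`spectralNorm.normedField`, the unique extension of the absolute value): an algebraically closed
  ultrametric normed field, with the same algebra structures; `norm_algebraMap_czBar : ‖x‖_𝒦 = ‖x‖`.
* `iota : PowerSeries ℂ →ₐ[ℂ[X]] CzBar` and **`norm_iota : ‖ι φ‖ = e^{−ord φ}`** (`φ ≠ 0`).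

Design: type synonyms keep the new norm instances off Mathlib's `ℂ⸨X⸩` and `AlgebraicClosure`
(no instance is overridden). The book's `𝒦` is moreover complete; completeness of the algebraically
closed field is not used by the Ch. 10 argument and is not provided here.

## References

* [NesterenkoPhilippon2001] Yu. V. Nesterenko, P. Philippon (eds.), *Introduction to Algebraic
  Independence Theory*, LNM 1752, Springer 2001, Ch. 10 §2 (p. 152).
-/

noncomputable section

open scoped Polynomial NNReal LaurentSeries
open WithZero

namespace Literature.NumberTheory.Transcendental

namespace NesterenkoMultiplicity

/-- The field `𝒦₀ = ℂ⸨z⸩` of Laurent series — a type synonym of `LaurentSeries ℂ` carrying the absolute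
value `|φ| = e^{−ord φ}` of LNM 1752 Ch. 10 §2. [cite: NesterenkoPhilippon2001, Ch. 10 §2 (p. 152)] -/
def CLaurent : Type := ℂ⸨X⸩

/-- Structure transported to / built on the type synonym (see the module docstring). [folklore] -/
instance : Field CLaurent := inferInstanceAs (Field ℂ⸨X⸩)
/-- Structure transported to / built on the type synonym (see the module docstring). [folklore] -/
instance : Valued CLaurent ℤᵐ⁰ := inferInstanceAs (Valued ℂ⸨X⸩ ℤᵐ⁰)
/-- Structure transported to / built on the type synonym (see the module docstring). [folklore] -/
instance : CompleteSpace CLaurent := inferInstanceAs (CompleteSpace ℂ⸨X⸩)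
/-- Structure transported to / built on the type synonym (see the module docstring). [folklore] -/
instance : Algebra (PowerSeries ℂ) CLaurent := inferInstanceAs (Algebra (PowerSeries ℂ) ℂ⸨X⸩)
/-- Structure transported to / built on the type synonym (see the module docstring). [folklore] -/
instance : Algebra ℂ[X] CLaurent := inferInstanceAs (Algebra ℂ[X] ℂ⸨X⸩)
/-- Structure transported to / built on the type synonym (see the module docstring). [folklore] -/
instance : Algebra ℂ CLaurent := inferInstanceAs (Algebra ℂ ℂ⸨X⸩)
/-- Structure transported to / built on the type synonym (see the module docstring). [folklore] -/
instance : FaithfulSMul ℂ[X] CLaurent := inferInstanceAs (FaithfulSMul ℂ[X] ℂ⸨X⸩)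
/-- Structure transported to / built on the type synonym (see the module docstring). [folklore] -/
instance : Algebra (RatFunc ℂ) CLaurent := RatFunc.liftAlgebra ℂ CLaurent
/-- Structure transported to / built on the type synonym (see the module docstring). [folklore] -/
instance : IsScalarTower ℂ[X] (RatFunc ℂ) CLaurent := RatFunc.isScalarTower_liftAlgebra ℂ CLaurent

/-- `algebraMap ℂ⟦X⟧ CLaurent` is the Hahn-series embedding. [folklore] -/
theorem algebraMap_powerSeries_apply (φ : PowerSeries ℂ) :
    algebraMap (PowerSeries ℂ) CLaurent φ = (HahnSeries.ofPowerSeries ℤ ℂ φ : ℂ⸨X⸩) := rfl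

/-- `algebraMap ℂ[X] CLaurent` factors through `ℂ⟦X⟧`. [folklore] -/
theorem algebraMap_polynomial_apply (q : ℂ[X]) :
    algebraMap ℂ[X] CLaurent q = (HahnSeries.ofPowerSeries ℤ ℂ (q : PowerSeries ℂ) : ℂ⸨X⸩) := rfl

/-- Structure transported to / built on the type synonym (see the module docstring). [folklore] -/
instance : IsScalarTower ℂ[X] (PowerSeries ℂ) CLaurent :=
  IsScalarTower.of_algebraMap_eq fun _ => rfl

/-- `algebraMap ℂ CLaurent c` is the constant Laurent series `c`. [folklore] -/
theorem algebraMap_complex_apply (c : ℂ) :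
    algebraMap ℂ CLaurent c = (HahnSeries.C c : ℂ⸨X⸩) := by
  change algebraMap ℂ ℂ⸨X⸩ c = HahnSeries.C c
  rw [HahnSeries.algebraMap_apply', PowerSeries.algebraMap_apply]; simp

/-- Structure transported to / built on the type synonym (see the module docstring). [folklore] -/
instance : IsScalarTower ℂ ℂ[X] CLaurent :=
  IsScalarTower.of_algebraMap_eq fun c => by
    rw [algebraMap_complex_apply]
    change (HahnSeries.C c : ℂ⸨X⸩) = HahnSeries.ofPowerSeries ℤ ℂ ((algebraMap ℂ ℂ[X] c : ℂ[X]) : PowerSeries ℂ)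
    rw [Polynomial.algebraMap_apply]
    simp [Polynomial.coe_C, HahnSeries.ofPowerSeries_C]

/-- Structure transported to / built on the type synonym (see the module docstring). [folklore] -/
instance : IsScalarTower ℂ (PowerSeries ℂ) CLaurent :=
  IsScalarTower.of_algebraMap_eq fun c => by
    rw [algebraMap_complex_apply]
    change (HahnSeries.C c : ℂ⸨X⸩) = HahnSeries.ofPowerSeries ℤ ℂ (algebraMap ℂ (PowerSeries ℂ) c)
    rw [PowerSeries.algebraMap_apply]
    simp [HahnSeries.ofPowerSeries_C]

/-- The valuation of `CLaurent` is the `X`-adic valuation of `ℂ⸨X⸩`. [folklore] -/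
theorem valuation_eq : (Valued.v : Valuation CLaurent ℤᵐ⁰) = (PowerSeries.idealX ℂ).valuation ℂ⸨X⸩ := rfl

/-- Structure transported to / built on the type synonym (see the module docstring). [folklore] -/
instance : (Valued.v : Valuation CLaurent ℤᵐ⁰).IsNontrivial :=
  inferInstanceAs ((PowerSeries.idealX ℂ).valuation ℂ⸨X⸩).IsNontrivial

/-- Structure transported to / built on the type synonym (see the module docstring). [folklore] -/
instance : (Valued.v : Valuation CLaurent ℤᵐ⁰).IsRankOneDiscrete :=
  Valuation.IsRankOneDiscrete.mk' _

/-- The base `e` of the absolute value `|α| = e^{−ord α}`. [cite: NesterenkoPhilippon2001, Ch. 10 §2 (p. 152)] -/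
def expBase : ℝ≥0 := ⟨Real.exp 1, (Real.exp_pos 1).le⟩

/-- `e > 1`. [folklore] -/
theorem one_lt_expBase : 1 < expBase := by
  rw [← NNReal.coe_lt_coe]
  show (1 : ℝ) < Real.exp 1
  exact Real.one_lt_exp_iff.mpr one_pos

/-- Structure transported to / built on the type synonym (see the module docstring). [folklore] -/
instance rankOneCLaurent : (Valued.v : Valuation CLaurent ℤᵐ⁰).RankOne :=
  Valuation.IsRankOneDiscrete.rankOne _ one_lt_expBase

/-- Structure transported to / built on the type synonym (see the module docstring). [folklore] -/
instance : NormedField CLaurent := Valued.toNormedField CLaurent ℤᵐ⁰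

/-- Structure transported to / built on the type synonym (see the module docstring). [folklore] -/
instance : IsUltrametricDist CLaurent :=
  IsUltrametricDist.isUltrametricDist_of_forall_norm_add_le_max_norm fun x y =>
    Valuation.norm_add_le _ x y

/-- The valuation of `CLaurent` is surjective. [folklore] -/
theorem valuation_surjective : Function.Surjective (Valued.v : Valuation CLaurent ℤᵐ⁰) := by
  intro γ
  induction γ with
  | zero => exact ⟨0, map_zero _⟩
  | coe u =>
    refine ⟨(HahnSeries.single (-Multiplicative.toAdd u) (1 : ℂ) : ℂ⸨X⸩), ?_⟩
    show Valued.v (HahnSeries.single (-Multiplicative.toAdd u) (1 : ℂ) : ℂ⸨X⸩) = _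
    rw [LaurentSeries.valuation_single_zpow, neg_neg]
    rfl

/-- The embedding `hom'` of the rank-one structure, by definition. [folklore] -/
theorem rankOne_hom'_def : rankOneCLaurent.hom' = (WithZeroMulInt.toNNReal one_lt_expBase.ne_bot).comp
    (Valuation.IsRankOneDiscrete.valueGroup₀_equiv_withZeroMulInt
      (Valued.v : Valuation CLaurent ℤᵐ⁰)).toMonoidWithZeroHom := rfl

/-- **`‖x‖ = e^{log-valuation}`**: the norm of `CLaurent` is `toNNReal e (v x)`. [folklore] -/
theorem norm_eq_toNNReal (x : CLaurent) :
    ‖x‖ = WithZeroMulInt.toNNReal one_lt_expBase.ne_bot (Valued.v x) := by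
  simp [Valued.toNormedField.norm_def, Valuation.RankOne.hom, rankOne_hom'_def,
    Valuation.IsRankOneDiscrete.valueGroup₀_equiv_withZeroMulInt_restrict_apply_of_surjective
      valuation_surjective]

/-- `toNNReal e (exp k) = e ^ k`. [folklore] -/
theorem toNNReal_exp {e : ℝ≥0} (he : e ≠ 0) (k : ℤ) : WithZeroMulInt.toNNReal he (exp k) = e ^ k := by
  rw [WithZeroMulInt.toNNReal_neg_apply he exp_ne_zero]
  rfl

/-- **The valuation of a power series is `exp(−ord)`.** [folklore] -/
theorem valuation_algebraMap_powerSeries {φ : PowerSeries ℂ} (hφ : φ ≠ 0) :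
    Valued.v (algebraMap (PowerSeries ℂ) CLaurent φ) = exp (-(φ.order.toNat : ℤ)) := by
  set n := φ.order.toNat with hn
  change Valued.v ((φ : ℂ⸨X⸩)) = _
  have h1 : Valued.v (φ : ℂ⸨X⸩) ≤ exp (-(n : ℤ)) :=
    (LaurentSeries.intValuation_le_iff_coeff_lt_eq_zero ℂ φ).mpr
      fun k hk => PowerSeries.coeff_of_lt_order_toNat k (by rw [← hn]; exact hk)
  have h2 : ¬ Valued.v (φ : ℂ⸨X⸩) ≤ exp (-((n + 1 : ℕ) : ℤ)) := fun h =>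
    PowerSeries.coeff_order hφ ((LaurentSeries.intValuation_le_iff_coeff_lt_eq_zero ℂ φ).mp h n (by omega))
  have h0 : Valued.v (φ : ℂ⸨X⸩) ≠ 0 :=
    (Valuation.ne_zero_iff _).mpr (by
      rw [Ne, ← PowerSeries.coe_zero, (HahnSeries.ofPowerSeries_injective).eq_iff]; exact hφ)
  rw [← exp_log h0] at h1 h2 ⊢
  rw [exp_le_exp] at h1 h2
  rw [exp_inj]
  push_cast at h2
  omega

/-- **`|φ| = e^{−ord φ}`** for a non-zero power series `φ ∈ ℂ⟦z⟧ ⊂ 𝒦₀`.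
[cite: NesterenkoPhilippon2001, Ch. 10 §2 (p. 152)] -/
theorem norm_algebraMap_powerSeries {φ : PowerSeries ℂ} (hφ : φ ≠ 0) :
    ‖algebraMap (PowerSeries ℂ) CLaurent φ‖ = Real.exp (-((φ.order).toNat : ℝ)) := by
  rw [norm_eq_toNNReal, valuation_algebraMap_powerSeries hφ, toNNReal_exp, NNReal.coe_zpow, zpow_neg,
    zpow_natCast, Real.exp_neg]
  congr 1
  show Real.exp 1 ^ (φ.order).toNat = _
  rw [← Real.exp_nat_mul, mul_one]

/-- The embedding `ι : ℂ⟦z⟧ → 𝒦₀` as a `ℂ[z]`-algebra map. [cite: NesterenkoPhilippon2001, Ch. 10 §2 (p. 152)] -/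
def iota₀ : PowerSeries ℂ →ₐ[ℂ[X]] CLaurent := IsScalarTower.toAlgHom ℂ[X] (PowerSeries ℂ) CLaurent

/-- `ι φ = φ` viewed in `𝒦₀`. [folklore] -/
theorem iota₀_apply (φ : PowerSeries ℂ) : iota₀ φ = algebraMap (PowerSeries ℂ) CLaurent φ := rfl

/-- **`‖ι φ‖ = e^{−ord φ}`** (the hypothesis `hι` of the Ch. 10 assembly, for `𝒦₀`).
[cite: NesterenkoPhilippon2001, Ch. 10 §2 (p. 152)] -/
theorem norm_iota₀ (φ : PowerSeries ℂ) (hφ : φ ≠ 0) : ‖iota₀ φ‖ = Real.exp (-((φ.order).toNat : ℝ)) :=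
  norm_algebraMap_powerSeries hφ

/-- `‖X‖ = e^{−1} ≠ 1`: `CLaurent` is nontrivially normed. [folklore] -/
theorem norm_X_CLaurent : ‖(algebraMap (PowerSeries ℂ) CLaurent PowerSeries.X)‖ = Real.exp (-1) := by
  rw [norm_algebraMap_powerSeries PowerSeries.X_ne_zero, PowerSeries.order_X]
  norm_num

/-- `ℂ⟦z⟧ → 𝒦₀` is injective. [folklore] -/
theorem algebraMap_powerSeries_injective : Function.Injective (algebraMap (PowerSeries ℂ) CLaurent) :=
  HahnSeries.ofPowerSeries_injective

/-- Structure transported to / built on the type synonym (see the module docstring). [folklore] -/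
instance : NontriviallyNormedField CLaurent :=
  NontriviallyNormedField.ofNormNeOne ⟨algebraMap (PowerSeries ℂ) CLaurent PowerSeries.X,
    (map_ne_zero_iff _ algebraMap_powerSeries_injective).mpr PowerSeries.X_ne_zero, by
      rw [norm_X_CLaurent]
      exact (Real.exp_lt_one_iff.mpr (by norm_num)).ne⟩

/-- Structure transported to / built on the type synonym (see the module docstring). [folklore] -/
instance : CharZero CLaurent := charZero_of_injective_algebraMap (algebraMap ℂ CLaurent).injective

/-! ### The field `𝒦`: an algebraic closure of `ℂ⸨z⸩` with the extended absolute value -/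

/-- The field `𝒦 ⊇ ℂ(z)` of LNM 1752 Ch. 10 §2: an algebraically closed valued field extending
`(ℂ⸨z⸩, e^{−ord})` — here the algebraic closure of `ℂ⸨z⸩` with the spectral norm (the unique extension of
the absolute value; the book completes once more, which the Ch. 10 argument does not use).
[cite: NesterenkoPhilippon2001, Ch. 10 §2 (p. 152)] -/
def CzBar : Type := AlgebraicClosure CLaurent

/-- Structure transported to / built on the type synonym (see the module docstring). [folklore] -/
instance : Field CzBar := inferInstanceAs (Field (AlgebraicClosure CLaurent))
/-- Structure transported to / built on the type synonym (see the module docstring). [folklore] -/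
instance : Algebra CLaurent CzBar := inferInstanceAs (Algebra CLaurent (AlgebraicClosure CLaurent))
/-- Structure transported to / built on the type synonym (see the module docstring). [folklore] -/
instance : Algebra.IsAlgebraic CLaurent CzBar :=
  inferInstanceAs (Algebra.IsAlgebraic CLaurent (AlgebraicClosure CLaurent))
/-- Structure transported to / built on the type synonym (see the module docstring). [folklore] -/
instance : IsAlgClosed CzBar := inferInstanceAs (IsAlgClosed (AlgebraicClosure CLaurent))
/-- Structure transported to / built on the type synonym (see the module docstring). [folklore] -/
instance : CharZero CzBar := inferInstanceAs (CharZero (AlgebraicClosure CLaurent))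
/-- Structure transported to / built on the type synonym (see the module docstring). [folklore] -/
instance : Algebra ℂ CzBar := inferInstanceAs (Algebra ℂ (AlgebraicClosure CLaurent))
/-- Structure transported to / built on the type synonym (see the module docstring). [folklore] -/
instance : Algebra ℂ[X] CzBar := inferInstanceAs (Algebra ℂ[X] (AlgebraicClosure CLaurent))
/-- Structure transported to / built on the type synonym (see the module docstring). [folklore] -/
instance : Algebra (RatFunc ℂ) CzBar := inferInstanceAs (Algebra (RatFunc ℂ) (AlgebraicClosure CLaurent))
/-- Structure transported to / built on the type synonym (see the module docstring). [folklore] -/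
instance : Algebra (PowerSeries ℂ) CzBar := inferInstanceAs (Algebra (PowerSeries ℂ) (AlgebraicClosure CLaurent))
/-- Structure transported to / built on the type synonym (see the module docstring). [folklore] -/
instance : IsScalarTower ℂ[X] CLaurent CzBar :=
  inferInstanceAs (IsScalarTower ℂ[X] CLaurent (AlgebraicClosure CLaurent))
/-- Structure transported to / built on the type synonym (see the module docstring). [folklore] -/
instance : IsScalarTower (RatFunc ℂ) CLaurent CzBar :=
  inferInstanceAs (IsScalarTower (RatFunc ℂ) CLaurent (AlgebraicClosure CLaurent))
/-- Structure transported to / built on the type synonym (see the module docstring). [folklore] -/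
instance : IsScalarTower (PowerSeries ℂ) CLaurent CzBar :=
  inferInstanceAs (IsScalarTower (PowerSeries ℂ) CLaurent (AlgebraicClosure CLaurent))
/-- Structure transported to / built on the type synonym (see the module docstring). [folklore] -/
instance : IsScalarTower ℂ CLaurent CzBar :=
  inferInstanceAs (IsScalarTower ℂ CLaurent (AlgebraicClosure CLaurent))

/-- Scalar towers through `CLaurent` descend to `CzBar`. [folklore] -/
theorem isScalarTower_czBar_of {R S : Type*} [CommSemiring R] [CommSemiring S] [Algebra R S]
    [Algebra R CLaurent] [Algebra S CLaurent] [IsScalarTower R S CLaurent] [Algebra R CzBar] [Algebra S CzBar]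
    [IsScalarTower R CLaurent CzBar] [IsScalarTower S CLaurent CzBar] : IsScalarTower R S CzBar :=
  IsScalarTower.of_algebraMap_eq fun r => by
    rw [IsScalarTower.algebraMap_apply R CLaurent CzBar, IsScalarTower.algebraMap_apply S CLaurent CzBar,
      IsScalarTower.algebraMap_apply R S CLaurent]

/-- Structure transported to / built on the type synonym (see the module docstring). [folklore] -/
instance : IsScalarTower ℂ[X] (RatFunc ℂ) CzBar := isScalarTower_czBar_of
/-- Structure transported to / built on the type synonym (see the module docstring). [folklore] -/
instance : IsScalarTower ℂ[X] (PowerSeries ℂ) CzBar := isScalarTower_czBar_of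
/-- Structure transported to / built on the type synonym (see the module docstring). [folklore] -/
instance : IsScalarTower ℂ ℂ[X] CzBar := isScalarTower_czBar_of

/-- Structure transported to / built on the type synonym (see the module docstring). [folklore] -/
instance : NormedField CzBar := spectralNorm.normedField CLaurent CzBar

/-- **The absolute value of `𝒦` extends that of `ℂ⸨z⸩`.** [folklore] -/
theorem norm_algebraMap_czBar (x : CLaurent) : ‖algebraMap CLaurent CzBar x‖ = ‖x‖ :=
  spectralNorm_extends x

/-- Structure transported to / built on the type synonym (see the module docstring). [folklore] -/
instance : IsUltrametricDist CzBar :=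
  IsUltrametricDist.isUltrametricDist_of_forall_norm_add_le_max_norm fun x y =>
    isNonarchimedean_spectralNorm x y

/-- The embedding `ι : ℂ⟦z⟧ → 𝒦` of LNM 1752 Ch. 10 §2, as a `ℂ[z]`-algebra map.
[cite: NesterenkoPhilippon2001, Ch. 10 §2 (p. 152)] -/
def iota : PowerSeries ℂ →ₐ[ℂ[X]] CzBar := IsScalarTower.toAlgHom ℂ[X] (PowerSeries ℂ) CzBar

/-- `ι φ` is `φ` mapped along `ℂ⟦z⟧ → ℂ⸨z⸩ → 𝒦`. [folklore] -/
theorem iota_apply (φ : PowerSeries ℂ) :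
    iota φ = algebraMap CLaurent CzBar (algebraMap (PowerSeries ℂ) CLaurent φ) := by
  rw [← IsScalarTower.algebraMap_apply]; rfl

/-- **`‖ι φ‖ = e^{−ord φ}`** — the hypothesis `hι` of the Ch. 10 assembly (`thm_1_1_of_toolkit`) for
`L = 𝒦`. [cite: NesterenkoPhilippon2001, Ch. 10 §2 (p. 152)] -/
theorem norm_iota (φ : PowerSeries ℂ) (hφ : φ ≠ 0) : ‖iota φ‖ = Real.exp (-((φ.order).toNat : ℝ)) := by
  rw [iota_apply, norm_algebraMap_czBar, norm_algebraMap_powerSeries hφ]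

end NesterenkoMultiplicity

end Literature.NumberTheory.Transcendental
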